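import Literature.Analysis.FluidPDE.VectorCalculus

/-!
# Vector calculus for fluid mechanics: discharges of `∫ ⟪(u·∇)u, u⟫ = 0`, `‖curl v‖² = ½ |Dv − Dvᵀ|²`, `div (curl v) = 0`

Sibling of `VectorCalculus.lean` (named facts `Literature.Analysis.FluidPDE.integral_inner_convect_self_eq_zero`: the
convective term is `L²`-skew on smooth, compactly supported, divergence-free fields; and
`Literature.Analysis.FluidPDE.norm_curl_sq_eq_frobeniusNormSq_spin`: in `ℝ³` the vorticity carries the same
information as the spin matrix; and `Literature.Analysis.FluidPDE.divergence_curl_eq_zero`: `div (curl v) = 0` for `C²`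
fields on `ℝ³`). Kept in a leaf file so that the definitions file is not rewritten.

`integral_inner_convect_self_eq_zero`. The printed source is Majda–Bertozzi, §1.7, **Lemma 1.5**
(p. 25, proof p. 27): for a smooth divergence-free vector field `w` on `ℝᴺ` and a smooth scalar `q`
with `|w| |q| = O(|x|^{1-N})` (eq. (1.76)), `∫ w · ∇q dx = 0` (eq. (1.77)); the energy step of the
proof of Prop. 1.12 (p. 26) and the basic energy identity of §3.1.1 apply it with `q = ½|v|²`, i.e.
`∫ (v·∇v)·v = ∫ v · ∇(½|v|²) = 0`. For a compactly supported smooth `u` the decay hypothesis (1.76)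
is void and `q = ½‖u‖²` is a test function, so Lemma 1.5 is exactly the in-tree discharge
`Literature.Analysis.FluidPDE.VectorCalculus.IsDivFree.isWeaklyDivFree_holds` (`∫ ⟪u, ∇θ⟫ = 0` for `C¹` divergence-free `u` and test
`θ`); the only remaining step is the pointwise identity `⟪Du(x)[u(x)], u(x)⟫ = ⟪u(x), ∇(½‖u‖²)(x)⟫`
(chain rule for `‖·‖²`, Mathlib `HasFDerivAt.norm_sq`).

`norm_curl_sq_eq_frobeniusNormSq_spin`. The printed source is Majda–Bertozzi, §1.4 "The vorticity,
a deformation matrix, and some elementary exact solutions" (p. 6), eqs. (1.18)–(1.21): the velocity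
gradient `∇v` splits into the deformation matrix `𝒟 = ½(∇v + ∇vᵗ)` (1.18) and the rotation matrix
`Ω = ½(∇v − ∇vᵗ)` (1.19), and the vorticity `ω = curl v` (1.20) satisfies `Ω h = ½ ω × h` for all
`h ∈ ℝ³` (1.21); hence `2Ω = ∇v − ∇vᵗ = spin v` is the antisymmetric matrix with off-diagonal
entries `±ωₖ`, and `|∇v − ∇vᵗ|²_F = 2 |ω|²`. The Lean proof is the same finite-dimensional
algebra: expand both sides in the standard orthonormal basis of `ℝ³` and compare.

`divergence_curl_eq_zero`. Majda–Bertozzi use `div ω = 0` for `ω = curl v` as a standard vector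
identity without proof: §1.7, proof of Prop. 1.12 (p. 26: "Because `div v = 0` and `ω = curl v`, we
have `div ω ≡ 0`", in the vorticity-flux step (1.65) and, as "the compatibility condition
`div ω = 0`", in the helicity step (1.67)), and again in §2.3.2 (3D Beltrami flows, after eq. (2.38)).
The proof here is the symmetry of second derivatives: `curl v = C ∘ Dv` for a fixed linear map `C`
of the velocity gradient (definitionally, from `Literature.Analysis.FluidPDE.curl`), so `D(curl v)(x) = C ∘ D²v(x)` by
the chain rule; expanding `div = tr` in the standard frame (`divergence_eq_sum_inner_fderiv`) gives
six mixed second partials which cancel pairwise by Schwarz's theorem for `C²` maps (Mathlib's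
`ContDiffAt.isSymmSndFDerivAt`).

* `Literature.Fluid.integral_inner_convect_self_eq_zero_holds : integral_inner_convect_self_eq_zero`.
* `Literature.Fluid.norm_curl_sq_eq_frobeniusNormSq_spin_holds : norm_curl_sq_eq_frobeniusNormSq_spin`.
* `Literature.Fluid.divergence_curl_eq_zero_holds : divergence_curl_eq_zero`.

## References

* A. J. Majda, A. L. Bertozzi, *Vorticity and Incompressible Flow*, Cambridge Texts in Applied
  Mathematics (CUP 2002), doi:10.1017/cbo9780511613203 (`MajdaBertozziCUP2002`): §1.7, Lemma 1.5,
  eqs. (1.76)–(1.77) (p. 25; proof p. 27); proof of Prop. 1.12, conservation of vorticity flux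
  (1.65), energy (1.66) and helicity (1.67) (p. 26: `div ω ≡ 0` for `ω = curl v`); §3.1.1 (basic
  energy identity); §1.4, eqs. (1.18)–(1.22) (p. 6: deformation and rotation matrices, vorticity,
  `Ω h = ½ ω × h`); §2.3.2 (3D Beltrami flows: "the vorticity satisfies the compatibility condition
  `div ω = 0`").
-/

noncomputable section

open MeasureTheory TopologicalSpace
open scoped InnerProductSpace RealInnerProductSpace

namespace Literature.Analysis.FluidPDE

variable {E : Type*} [NormedAddCommGroup E] [InnerProductSpace ℝ E] [FiniteDimensional ℝ E]
variable [MeasurableSpace E] [BorelSpace E]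

/-- **Discharge** of `integral_inner_convect_self_eq_zero`: for a smooth, compactly supported,
divergence-free `u : E → E`, `∫ ⟪(u·∇)u, u⟫ = 0`. Proof as printed (Majda–Bertozzi, §1.7,
Lemma 1.5, eq. (1.77): `∫ w · ∇q = 0` for smooth divergence-free `w` and smooth `q` with
`|w| |q| = O(|x|^{1-N})`, applied with `w = u`, `q = ½|u|²` as in the energy step of the proof of
Prop. 1.12 and in §3.1.1 — the decay hypothesis (1.76) is void for compactly supported `u`):
pointwise `⟪Du(x)[u(x)], u(x)⟫ = ⟪u(x), ∇θ(x)⟫` with `θ = ½‖u‖²` a test function, and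
`∫ ⟪u, ∇θ⟫ = 0` is `IsDivFree.isWeaklyDivFree_holds` (Lemma 1.5 for test functions `q`).
[cite: MajdaBertozziCUP2002, §1.7 Lemma 1.5 eq. (1.77), p. 25 (proof p. 27); §3.1.1] -/
theorem integral_inner_convect_self_eq_zero_holds :
    integral_inner_convect_self_eq_zero (E := E) := by
  intro u hu hdiv
  have hu1 : ContDiff ℝ 1 u := hu.contDiff.of_le (by exact_mod_cast le_top)
  -- `θ = ½ |u|²` is a test function on the whole space
  set θ : E → ℝ := fun y => 2⁻¹ * ‖u y‖ ^ 2
  have hθ : FunctionSpaces.IsTestFunctionOn (⊤ : Opens E) θ :=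
    ⟨(contDiff_const.mul (contDiff_norm_sq ℝ)).comp hu.contDiff,
      hu.hasCompactSupport.comp_left (g := fun v : E => (2⁻¹ : ℝ) * ‖v‖ ^ 2) (by simp), by simp⟩
  -- pointwise: `⟪u, ∇θ⟫ = Dθ[u] = ½ · 2 ⟪u, Du[u]⟫ = ⟪(u·∇)u, u⟫`
  have hpt : ∀ x, ⟪u x, gradient θ x⟫ = ⟪convect u u x, u x⟫ := by
    intro x
    have hd : HasFDerivAt θ ((2⁻¹ : ℝ) • ((2 : ℕ) • (innerSL ℝ (u x)).comp (fderiv ℝ u x))) x :=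
      ((hu1.differentiable one_ne_zero x).hasFDerivAt.norm_sq).const_mul 2⁻¹
    rw [gradient, real_inner_comm, InnerProductSpace.toDual_symm_apply, hd.fderiv, convect_apply]
    simp only [_root_.smul_apply, ContinuousLinearMap.coe_comp,
      Function.comp_apply, innerSL_apply_apply, nsmul_eq_mul, smul_eq_mul]
    rw [real_inner_comm (u x)]
    ring
  simp_rw [← hpt]
  exact VectorCalculus.IsDivFree.isWeaklyDivFree_holds hdiv hu1 θ hθ

/-! ### Discharge: `‖curl v‖² = ½ |Dv − Dvᵀ|²` -/

/-- **Discharge** of `norm_curl_sq_eq_frobeniusNormSq_spin`: in `ℝ³`,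
`‖curl v (x)‖² = ½ |Dv(x) − Dv(x)ᵀ|²` (Frobenius norm). Source: Majda–Bertozzi, §1.4
"The vorticity, a deformation matrix, and some elementary exact solutions", eqs. (1.19)–(1.21):
the rotation matrix `Ω = ½ (∇v − ∇vᵗ)` and the vorticity `ω = curl v` (1.20) satisfy
`Ω h = ½ ω × h` for all `h ∈ ℝ³` (1.21), i.e. `2Ω = ∇v − ∇vᵗ` is the antisymmetric matrix with
off-diagonal entries `±ω₁, ±ω₂, ±ω₃`, whence `|2Ω|² = 2 |ω|²`. Proof as printed (pure linear
algebra, the differentiability hypothesis is not used): write `L = Dv(x)`, `Lⱼᵢ = (L eⱼ)ᵢ` in the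
standard orthonormal basis `eⱼ = EuclideanSpace.single j 1`; the adjoint has coordinates
`(Lᵀ eᵢ)ₖ = (L eₖ)ᵢ` (`ContinuousLinearMap.adjoint_inner_right`), so
`|L − Lᵀ|² = ∑ᵢₖ (Lᵢₖ − Lₖᵢ)²` (`frobeniusNormSq_eq_sum` in the basis `EuclideanSpace.basisFun`),
while `‖curl v x‖² = (L₁₂ − L₂₁)² + (L₂₀ − L₀₂)² + (L₀₁ − L₁₀)²`; expand the `3 × 3` sums and
`ring`. (The fact's docstring locates this at "§1.2, eqs. (1.22)–(1.24)"; in the printed book the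
decomposition is §1.4, eqs. (1.18)–(1.22), p. 6 — same statement.) [cite: MajdaBertozziCUP2002, §1.4 eqs. (1.19)–(1.21), p. 6] -/
theorem norm_curl_sq_eq_frobeniusNormSq_spin_holds : norm_curl_sq_eq_frobeniusNormSq_spin := by
  intro v x _
  set L : EuclideanSpace ℝ (Fin 3) →L[ℝ] EuclideanSpace ℝ (Fin 3) := fderiv ℝ v x with hL
  -- coordinates of the adjoint: `(Lᵀ eᵢ)ₖ = (L eₖ)ᵢ`
  have hadj : ∀ i k : Fin 3,
      (ContinuousLinearMap.adjoint L (EuclideanSpace.single i 1)) k =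
        L (EuclideanSpace.single k 1) i := by
    intro i k
    have h1 := EuclideanSpace.inner_single_left k (1 : ℝ)
      (ContinuousLinearMap.adjoint L (EuclideanSpace.single i 1))
    rw [ContinuousLinearMap.adjoint_inner_right, EuclideanSpace.inner_single_right] at h1
    simpa using h1.symm
  -- coordinates of the spin matrix: `((L − Lᵀ) eᵢ)ₖ = Lᵢₖ − Lₖᵢ`
  have hspin : ∀ i k : Fin 3,
      spin v x (EuclideanSpace.single i 1) k =
        L (EuclideanSpace.single i 1) k - L (EuclideanSpace.single k 1) i := by
    intro i k
    rw [← hadj i k]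
    rfl
  -- Frobenius norm of the spin matrix in coordinates
  have hfrob : frobeniusNormSq (spin v x) =
      ∑ i, ∑ k, (L (EuclideanSpace.single i 1) k - L (EuclideanSpace.single k 1) i) ^ 2 := by
    rw [frobeniusNormSq_eq_sum (EuclideanSpace.basisFun (Fin 3) ℝ)]
    refine Finset.sum_congr rfl fun i _ => ?_
    rw [EuclideanSpace.norm_sq_eq]
    refine Finset.sum_congr rfl fun k _ => ?_
    rw [Real.norm_eq_abs, sq_abs, EuclideanSpace.basisFun_apply, hspin]
  -- the curl in coordinates
  have hcurl : ‖curl v x‖ ^ 2 =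
      (L (EuclideanSpace.single 1 1) 2 - L (EuclideanSpace.single 2 1) 1) ^ 2 +
      (L (EuclideanSpace.single 2 1) 0 - L (EuclideanSpace.single 0 1) 2) ^ 2 +
      (L (EuclideanSpace.single 0 1) 1 - L (EuclideanSpace.single 1 1) 0) ^ 2 := by
    rw [curl, EuclideanSpace.norm_sq_eq, Fin.sum_univ_three]
    simp [Real.norm_eq_abs, sq_abs, hL]
  rw [hcurl, hfrob]
  simp only [Fin.sum_univ_three]
  ring

/-! ### Discharge: `div (curl v) = 0` -/

/-- **Discharge** of `divergence_curl_eq_zero`: `div (curl v) = 0` for every `C²` vector field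
`v` on `ℝ³` — the "compatibility condition `div ω = 0`" for `ω = curl v` that Majda–Bertozzi use
without proof as a standard vector identity (§1.7, proof of Prop. 1.12, p. 26, vorticity-flux and
helicity steps; §2.3.2, 3D Beltrami flows). Proof (symmetry of second derivatives): `curl v = C ∘ Dv`
for a fixed linear map `C` of the velocity gradient (by `rfl` from the definition of `curl`), so by
the chain rule `D(curl v)(x) = C ∘ D²v(x)`; expanding `div = tr` in the standard frame
(`divergence_eq_sum_inner_fderiv` with `EuclideanSpace.basisFun`) gives the six mixed partials
`∂₀∂₁v₂ − ∂₀∂₂v₁ + ∂₁∂₂v₀ − ∂₁∂₀v₂ + ∂₂∂₀v₁ − ∂₂∂₁v₀`, which cancel pairwise because `D²v(x)` is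
symmetric for `C²` maps (Mathlib's `ContDiffAt.isSymmSndFDerivAt`, the only use of `hv` beyond
differentiability of `Dv`).
[cite: MajdaBertozziCUP2002, §1.7 proof of Prop. 1.12, p. 26 ("ω = curl v ⇒ div ω ≡ 0"); §2.3.2] -/
theorem divergence_curl_eq_zero_holds : divergence_curl_eq_zero := by
  intro v hv x
  -- the curl is a fixed linear function `C` of the velocity gradient: `curl v y = C (Dv(y))`
  let Cl : (EuclideanSpace ℝ (Fin 3) →L[ℝ] EuclideanSpace ℝ (Fin 3)) →ₗ[ℝ]
      EuclideanSpace ℝ (Fin 3) :=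
    { toFun := fun T => WithLp.toLp 2
        ![T (EuclideanSpace.single 1 1) 2 - T (EuclideanSpace.single 2 1) 1,
          T (EuclideanSpace.single 2 1) 0 - T (EuclideanSpace.single 0 1) 2,
          T (EuclideanSpace.single 0 1) 1 - T (EuclideanSpace.single 1 1) 0]
      map_add' := fun S T => by ext i; fin_cases i <;> simp <;> ring
      map_smul' := fun c T => by ext i; fin_cases i <;> simp <;> ring }
  let C : (EuclideanSpace ℝ (Fin 3) →L[ℝ] EuclideanSpace ℝ (Fin 3)) →L[ℝ]
      EuclideanSpace ℝ (Fin 3) := LinearMap.toContinuousLinearMap Cl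
  have hcurl : curl v = ⇑C ∘ fderiv ℝ v := rfl
  -- `Dv` is `C¹`, with derivative the second derivative `S = D²v(x)`, which is symmetric
  have h1 : ContDiff ℝ 1 (fderiv ℝ v) := hv.fderiv_right one_add_one_eq_two.le
  set S := fderiv ℝ (fderiv ℝ v) x with hS
  have hD2 : HasFDerivAt (fderiv ℝ v) S x := (h1.differentiable one_ne_zero x).hasFDerivAt
  have hsymm : IsSymmSndFDerivAt ℝ v x := hv.contDiffAt.isSymmSndFDerivAt (by simp)
  have h10 : S (EuclideanSpace.single 1 1) (EuclideanSpace.single 0 1) =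
      S (EuclideanSpace.single 0 1) (EuclideanSpace.single 1 1) := hsymm _ _
  have h20 : S (EuclideanSpace.single 2 1) (EuclideanSpace.single 0 1) =
      S (EuclideanSpace.single 0 1) (EuclideanSpace.single 2 1) := hsymm _ _
  have h21 : S (EuclideanSpace.single 2 1) (EuclideanSpace.single 1 1) =
      S (EuclideanSpace.single 1 1) (EuclideanSpace.single 2 1) := hsymm _ _
  -- chain rule: `D(curl v)(x) = C ∘ D²v(x)`
  have hDcurl : fderiv ℝ (curl v) x = C.comp S := by
    rw [hcurl]; exact (C.hasFDerivAt.comp x hD2).fderiv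
  -- expand the trace in the standard frame and cancel the six mixed partials pairwise
  rw [divergence_eq_sum_inner_fderiv (EuclideanSpace.basisFun (Fin 3) ℝ), hDcurl]
  simp only [EuclideanSpace.basisFun_apply, EuclideanSpace.inner_single_left, map_one, one_mul,
    Fin.sum_univ_three, ContinuousLinearMap.comp_apply, C, Cl,
    LinearMap.coe_toContinuousLinearMap', LinearMap.coe_mk, AddHom.coe_mk,
    Matrix.cons_val_zero, Matrix.cons_val_one, Matrix.cons_val_two, Matrix.head_cons,
    Matrix.tail_cons]
  rw [h10, h20, h21]
  ring

end Literature.Analysis.FluidPDE
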